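import Summits.KontsevichZagierPeriods.KontsevichZagierPeriods.Theses.IsogenyCertificates
import Summits.KontsevichZagierPeriods.KontsevichZagierPeriods.Theorems.IsogenyCertificatesXMapPeriodTransferStubCubicComponents

/-!
# `AlgebraicModuliRealPeriodCell` (stmt-KontsevichZagierPeriods-18265, route IsogenyCertificates) —
line `Sketch`, stub T: the two components of `{P > 0}` for a REAL depressed cubic

Port of the `ℚ`-line's `Theorems/IsogenyCertificatesXMapPeriodTransferStubCubicComponents.lean`
(moduli `A B : ℤ`) to real moduli `α β : ℝ` (no algebraicity is needed here: the content is pure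
real algebra). Structure of the positivity set `S = {y : ℝ | 0 < y³ + αy + β}`: with
`M = 1 + |α| + |β|` and `U = connectedComponentIn S M` the UNBOUNDED component of `S`,

* an interval `(u, ∞) ⊆ S` starting at a root `u` of `P` IS `U`;
* an interval `(u, v) ⊆ S` between two roots `u < v` of `P` IS the EGG `S ∖ U`.

Elementary root counting for a monic real cubic (three distinct real roots factor it — the generic
`cubicComponents_eq_prod_of_three_roots` of the `ℚ`-line, imported), the intermediate value
theorem and order-connectedness of preconnected subsets of `ℝ`.

References: M. Kontsevich, D. Zagier, *Periods* (2001), §1.2 (the calculus this line serves);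
the content of this file is folklore real algebra.
-/

noncomputable section

open Set Filter MeasureTheory Polynomial Topology
open Summit.KontsevichZagierPeriods.IsogenyCertificates.XMapPeriodTransferCells
  (cubicComponents_eq_prod_of_three_roots)

namespace Summit.KontsevichZagierPeriods.IsogenyCertificates.AlgRealPeriodCell.TransferCubicComponents

/-- Two-sided growth of the depressed cubic: `P(z) > 0` and `P(-z) < 0` for every
`z ≥ 1 + |α| + |β|`. [folklore] -/
theorem cubicComponents_sign_of_large_le (α β : ℝ) {z : ℝ} (hz : 1 + |α| + |β| ≤ z) :
    0 < z ^ 3 + α * z + β ∧ (-z) ^ 3 + α * (-z) + β < 0 := by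
  have hA : -|α| ≤ α := neg_abs_le _
  have hA' : α ≤ |α| := le_abs_self _
  have hB : -|β| ≤ β := neg_abs_le _
  have hB' : β ≤ |β| := le_abs_self _
  have h0A : 0 ≤ |α| := abs_nonneg _
  have h0B : 0 ≤ |β| := abs_nonneg _
  have hz1 : 1 ≤ z := by linarith
  have hz0 : 0 ≤ z := by linarith
  constructor
  · nlinarith [mul_le_mul_of_nonneg_left hA hz0, sq_nonneg z, mul_le_mul_of_nonneg_left hz1 hz0,
      mul_le_mul_of_nonneg_left hz hz0, mul_nonneg hz0 h0B]
  · nlinarith [mul_le_mul_of_nonneg_left hA' hz0, sq_nonneg z, mul_le_mul_of_nonneg_left hz1 hz0,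
      mul_le_mul_of_nonneg_left hz hz0, mul_nonneg hz0 h0B]

/-- `P(z) < 0` for every `z ≤ -(1 + |α| + |β|)`. [folklore] -/
theorem cubicComponents_neg_of_le_neg_large (α β : ℝ) {z : ℝ}
    (hz : z ≤ -(1 + |α| + |β|)) : z ^ 3 + α * z + β < 0 := by
  have h := (cubicComponents_sign_of_large_le α β (z := -z) (by linarith)).2
  rwa [neg_neg] at h

/-- Every real root of `X³ + αX + β` is `< 1 + |α| + |β|`. [folklore] -/
theorem cubicComponents_root_lt_large (α β : ℝ) {w : ℝ} (hw : w ^ 3 + α * w + β = 0) :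
    w < 1 + |α| + |β| := by
  by_contra h
  have := (cubicComponents_sign_of_large_le α β (not_lt.mp h)).1
  linarith

/-- Below any point where `P > 0` there is a real root of `P`. [folklore] -/
theorem cubicComponents_exists_root_lt (α β : ℝ) {y : ℝ} (hy : 0 < y ^ 3 + α * y + β) :
    ∃ t < y, t ^ 3 + α * t + β = 0 := by
  have hcont : Continuous fun x : ℝ => x ^ 3 + α * x + β := by fun_prop
  have h0 : 0 ≤ 1 + |α| + |β| := by positivity
  have hz₀y : -(1 + |α| + |β| + |y|) ≤ y := by
    have := neg_abs_le y
    linarith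
  have hPz₀ : (-(1 + |α| + |β| + |y|)) ^ 3 + α * (-(1 + |α| + |β| + |y|)) + β < 0 :=
    cubicComponents_neg_of_le_neg_large α β (by have := abs_nonneg y; linarith)
  obtain ⟨t, ht, hPt⟩ := intermediate_value_Icc hz₀y hcont.continuousOn ⟨hPz₀.le, hy.le⟩
  refine ⟨t, lt_of_le_of_ne ht.2 ?_, hPt⟩
  rintro rfl
  simp only at hPt
  linarith

/-- **Port of the registered stub `stub_cubicComponents`** of the `ℚ`-line to real moduli: with
`S = {P > 0}`, `U = connectedComponentIn S (1 + |α| + |β|)`, an interval `(u, ∞) ⊆ S` at a root `u`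
equals `U`, and an interval `(u, v) ⊆ S` between roots `u < v` equals the egg `S ∖ U`. (The
discriminant hypothesis is not used.) [folklore] -/
theorem stub_cubicComponents : ∀ (α β : ℝ), 4 * α ^ 3 + 27 * β ^ 2 ≠ 0 → ∀ (U : Set ℝ), U = connectedComponentIn {y : ℝ | 0 < y ^ 3 + α * y + β} (1 + |α| + |β|) → ∀ u : ℝ, u ^ 3 + α * u + β = 0 → (Set.Ioi u ⊆ {y : ℝ | 0 < y ^ 3 + α * y + β} → Set.Ioi u = U) ∧ ∀ v : ℝ, v ^ 3 + α * v + β = 0 → u < v → Set.Ioo u v ⊆ {y : ℝ | 0 < y ^ 3 + α * y + β} → Set.Ioo u v = {y : ℝ | 0 < y ^ 3 + α * y + β} \ U := by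
  intro α β _ U hU u hu
  -- Basic facts about `U`.
  have hUS : U ⊆ {y : ℝ | 0 < y ^ 3 + α * y + β} := by
    rw [hU]; exact connectedComponentIn_subset _ _
  have hMU : 1 + |α| + |β| ∈ U := by
    rw [hU]; exact mem_connectedComponentIn (cubicComponents_sign_of_large_le α β le_rfl).1
  have hIciU : Ici (1 + |α| + |β|) ⊆ U := by
    rw [hU]
    exact isPreconnected_Ici.subset_connectedComponentIn self_mem_Ici
      fun _ hz => (cubicComponents_sign_of_large_le α β hz).1
  have hUpre : IsPreconnected U := by
    rw [hU]; exact isPreconnected_connectedComponentIn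
  have huM := cubicComponents_root_lt_large α β hu
  refine ⟨fun hIoi => ?_, fun v hv huv hIoo => ?_⟩
  · -- (1) `(u, ∞) ⊆ S` with `P u = 0` is the unbounded component.
    apply Subset.antisymm
    · rw [hU]
      exact isPreconnected_Ioi.subset_connectedComponentIn huM hIoi
    · intro y hy
      by_contra hyu
      rw [mem_Ioi, not_lt] at hyu
      have huU : u ∈ U := hUpre.Icc_subset hy hMU ⟨hyu, huM.le⟩
      have := hUS huU
      simp only [mem_setOf_eq] at this
      linarith
  · -- (2) `(u, v) ⊆ S` between two roots is the egg.
    have hvM := cubicComponents_root_lt_large α β hv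
    have hcont : Continuous fun x : ℝ => x ^ 3 + α * x + β := by fun_prop
    apply Subset.antisymm
    · intro y hy
      refine ⟨hIoo hy, fun hyU => ?_⟩
      have hvU : v ∈ U := hUpre.Icc_subset hyU hMU ⟨hy.2.le, hvM.le⟩
      have := hUS hvU
      simp only [mem_setOf_eq] at this
      linarith
    · rintro y ⟨hyS, hyU⟩
      simp only [mem_setOf_eq] at hyS
      refine ⟨?_, ?_⟩
      · -- `u < y`: otherwise a third root `t < y < u < v` makes `P < 0` on `(u, v)`.
        by_contra hyu
        rw [not_lt] at hyu
        have hyu' : y < u := lt_of_le_of_ne hyu (by rintro rfl; linarith)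
        obtain ⟨t, hty, hPt⟩ := cubicComponents_exists_root_lt α β hyS
        have htu : t < u := hty.trans hyu'
        have key := cubicComponents_eq_prod_of_three_roots hPt hu hv htu.ne huv.ne
          (htu.trans huv).ne ((u + v) / 2)
        have hm : (u + v) / 2 ∈ Ioo u v := ⟨by linarith, by linarith⟩
        have hPm := hIoo hm
        simp only [mem_setOf_eq] at hPm
        have h1 : 0 < ((u + v) / 2 - t) * ((u + v) / 2 - u) :=
          mul_pos (by linarith) (by linarith)
        have h2 : ((u + v) / 2 - t) * ((u + v) / 2 - u) * ((u + v) / 2 - v) < 0 :=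
          mul_neg_of_pos_of_neg h1 (by linarith)
        linarith
      · -- `y < v`: otherwise a third root `u < v < y < t` makes `P y < 0`.
        by_contra hyv
        rw [not_lt] at hyv
        have hyv' : v < y := lt_of_le_of_ne hyv (by rintro rfl; linarith)
        have hyM : y < 1 + |α| + |β| := by
          by_contra h
          exact hyU (hIciU (not_lt.mp h))
        -- Some point of `[y, M]` has `P ≤ 0`, else `[y, M] ⊆ U`.
        have hz : ∃ z ∈ Icc y (1 + |α| + |β|), z ^ 3 + α * z + β ≤ 0 := by
          by_contra h
          push Not at h
          refine hyU ?_
          rw [hU]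
          exact isPreconnected_Icc.subset_connectedComponentIn (right_mem_Icc.mpr hyM.le)
            (fun z hz => h z hz) (left_mem_Icc.mpr hyM.le)
        obtain ⟨z, hzI, hPz⟩ := hz
        obtain ⟨t, ht, hPt⟩ := intermediate_value_Icc' hzI.1 hcont.continuousOn ⟨hPz, hyS.le⟩
        simp only at hPt
        have hyt : y < t := lt_of_le_of_ne ht.1 (by rintro rfl; linarith)
        have key := cubicComponents_eq_prod_of_three_roots hu hv hPt huv.ne (hyv'.trans hyt).ne
          (huv.trans (hyv'.trans hyt)).ne y
        have h1 : 0 < (y - u) * (y - v) := mul_pos (by linarith) (by linarith)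
        have h2 : (y - u) * (y - v) * (y - t) < 0 := mul_neg_of_pos_of_neg h1 (by linarith)
        linarith

end Summit.KontsevichZagierPeriods.IsogenyCertificates.AlgRealPeriodCell.TransferCubicComponents

end
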